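import Summits.MatrixMultiplication.OmegaCensus.STPP211Z2pow5RoomEngine
import Summits.MatrixMultiplication.OmegaCensus.STPP211Z2pow5Codes
import Summits.MatrixMultiplication.OmegaCensus.STPP211RoomLaw

/-!
# (2,1,1)⁶ in (ℤ/2)⁵ — the X-ROOM CERTIFICATE, part C1: reflection lemmas (masks, words, the true branch's state)

Cell `pub-omega` (unit `pub-omega-stpp-1-g35`), topic `Summits/MatrixMultiplication/OmegaCensus`.
HONEST FRAMING (verbatim): lottery ticket; floor = certified bounds/negative ranges. Census STRUCTURE bookkeeping (B5, T1 column at `(ℤ/2)⁵`;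
ROOM mechanism class of X-38); nothing here is a bound on `ω`.

SOUNDNESS OF `T1Z2p5.go` (`STPP211Z2pow5RoomEngine`): if the tables `ts` pass the one-sided table check `checkTabs C ts` (every set bit of
field `x` of table `i` is a code `x + cᵢ + cⱼ`) and `go ts 0 0 = true`, then EVERY translation-normal-form STPP family
`Aᵢ = {aᵢ, qᵢ}`, `Bᵢ = {0}`, `Cᵢ = {cᵢ}` of `𝔽₂⁵` with `enc (c i) = C[i]` and `enc (a i) < enc (q i)` has X-room set
`T1Room.roomX = univ` (`roomX_eq_univ_of_go`, file C2). This file C1 carries the lemmas: the branch of the search that places the true pairs is never cut — every filter the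
engine applies is an instance of the CKSU Def. 5.1 word (`word`), the counting prune passes because the future points are free
(`hasBits_of_card`), masks are read ONE-SIDEDLY (a set bit has a witness: `foldOr_spec`, `usedM_spec`, `F1M_spec`) — and at the leaf the
engine's `F1 = 2³² − 1` says every code is `enc (x + c_l + cⱼ)` with `x ∈ A_l`, i.e. every element is `(0 − cⱼ) + (c_l − x) ∈ roomX`.

References: H. Cohn, R. Kleinberg, B. Szegedy, C. Umans, FOCS 2005 (arXiv:math/0511460), Def. 5.1.
-/

namespace Summit.MatrixMultiplication.OmegaCensus

namespace T1Z2p5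

open Finset STPP211Neg Literature.Computability.AlgebraicComplexity T1Room

/-! ## Bit lemmas -/

/-- `bit k = 2 ^ k`. -/
theorem bit_eq_pow (k : ℕ) : bit k = 2 ^ k := by
  show Nat.shiftLeft 1 k = 2 ^ k
  rw [shiftLeft_eq', Nat.one_shiftLeft]

/-- Bits of `bit k`. -/
theorem testBit_bit {k i : ℕ} (h : (bit k).testBit i = true) : i = k := by
  rw [bit_eq_pow, Nat.testBit_two_pow] at h
  exact (of_decide_eq_true h).symm

/-- `bit k` has bit `k`. -/
theorem testBit_bit_self (k : ℕ) : (bit k).testBit k = true := by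
  rw [bit_eq_pow, Nat.testBit_two_pow_self]

/-- Bits of `Nat.lor`. -/
theorem testBit_lor' (a b i : ℕ) : (Nat.lor a b).testBit i = (a.testBit i || b.testBit i) := Nat.testBit_lor a b i

/-- Bits of `Nat.land`. -/
theorem testBit_land' (a b i : ℕ) : (Nat.land a b).testBit i = (a.testBit i && b.testBit i) := Nat.testBit_land a b i

/-- Bits of `Nat.xor`. -/
theorem testBit_xor' (a b i : ℕ) : (Nat.xor a b).testBit i = (a.testBit i ^^ b.testBit i) := Nat.testBit_xor a b i

/-- Bits of `full5 = 2³² − 1`. -/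
theorem testBit_full5 (i : ℕ) : full5.testBit i = decide (i < 32) := by
  show (4294967295 : ℕ).testBit i = _
  rw [show (4294967295 : ℕ) = 2 ^ 32 - 1 by norm_num, Nat.testBit_two_pow_sub_one]

/-- Bits of `lowMask k = 2ᵏ − 1`. -/
theorem testBit_lowMask (k i : ℕ) : (lowMask k).testBit i = decide (i < k) := by
  show (Nat.sub (Nat.shiftLeft 1 k) 1).testBit i = _
  rw [sub_eq', shiftLeft_eq', Nat.one_shiftLeft, Nat.testBit_two_pow_sub_one]

/-- Bits of a complement inside `full5`. -/
theorem testBit_cpl {X i : ℕ} : (cpl X).testBit i = true ↔ i < 32 ∧ X.testBit i = false := by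
  unfold cpl
  rw [testBit_xor', testBit_land', testBit_full5]
  by_cases hi : i < 32 <;> cases X.testBit i <;> simp [hi]

/-- **`foldOr` is one-sidedly sound:** every set bit of `foldOr f fuel F` is a set bit of some `f x` with `x` a set bit of `F`. -/
theorem foldOr_spec (f : ℕ → ℕ) : ∀ (fuel F z : ℕ), (foldOr f fuel F).testBit z = true →
    ∃ x, F.testBit x = true ∧ (f x).testBit z = true := by
  intro fuel
  induction fuel with
  | zero => intro F z h; simp [foldOr] at h
  | succ fuel ih =>
      intro F z h
      by_cases hF0 : F = 0
      · subst hF0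
        have : foldOr f (fuel + 1) 0 = 0 := rfl
        rw [this] at h; simp at h
      have hbeq : Nat.beq F 0 = false := IcosetW.beq_false_of_ne hF0
      have h' : (force (lowBit F) fun L => Nat.lor (f (Nat.log2 L)) (foldOr f fuel (Nat.xor F L))).testBit z = true := by
        have := h
        simp only [foldOr] at this ⊢
        rw [hbeq] at this
        exact this
      rw [force_eq, testBit_lor', Bool.or_eq_true] at h'
      obtain ⟨i, hi, hL, hrem, hbits⟩ := lowBit_spec hF0
      rw [hL, Nat.log2_two_pow] at h'
      rcases h' with h' | h'
      · exact ⟨i, hi, h'⟩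
      · have hrem' : Nat.xor F (2 ^ i) = Nat.land F (F - 1) := by rw [← hL]; exact hrem
        rw [hrem'] at h'
        obtain ⟨x, hx, hfx⟩ := ih _ z h'
        refine ⟨x, ?_, hfx⟩
        rw [hbits x] at hx
        revert hx; cases F.testBit x <;> simp

/-- One-sided semantics of `spread`. -/
theorem spread_spec {T used z : ℕ} (h : (spread T used).testBit z = true) :
    ∃ x, used.testBit x = true ∧ (fld T x).testBit z = true :=
  foldOr_spec _ _ _ _ h

/-- Fields are masks `< 2³²`. -/
theorem testBit_fld_lt {T x z : ℕ} (h : (fld T x).testBit z = true) : z < 32 := by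
  unfold fld at h
  rw [testBit_land', testBit_full5, Bool.and_eq_true] at h
  exact of_decide_eq_true h.2

/-! ## The one-sided table check -/

/-- ONE-SIDED TABLE CHECK: every set bit `z` of field `x < 32` of table `i` is a code `x + C[i] + C[j]` (`j < |C|`). -/
def checkTabs (C ts : List ℕ) : Bool :=
  (List.range C.length).all fun i => allC fun x => allC fun z =>
    !((fld (ts.getD i 0) x).testBit z) || (List.range C.length).any fun j => z == Nat.xor (Nat.xor x (C.getD i 0)) (C.getD j 0)

/-- Reading `checkTabs`. -/
theorem checkTabs_spec {C ts : List ℕ} (h : checkTabs C ts = true) {i x z : ℕ} (hi : i < C.length) (hx : x < 32)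
    (hz : (fld (ts.getD i 0) x).testBit z = true) : ∃ j < C.length, z = Nat.xor (Nat.xor x (C.getD i 0)) (C.getD j 0) := by
  have h1 := allC_spec (allC_spec (List.all_eq_true.1 h i (List.mem_range.2 hi)) hx) (testBit_fld_lt hz)
  rw [hz] at h1
  simp only [Bool.not_true, Bool.false_or, List.any_eq_true, List.mem_range, beq_iff_eq] at h1
  exact h1

/-! ## The word lemma and the normal-form family -/

/-- In `𝔽₂⁵` subtraction is addition. -/
theorem sub_eq_add5 : ∀ x y : G5, x - y = x + y := by decide

/-- In `𝔽₂⁵` every element is its own inverse. -/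
theorem add_self5 : ∀ x : G5, x + x = 0 := by decide

section Family

variable {a q c : Fin 6 → G5}

/-- **The CKSU word for translation-normal-form families** (`Bᵢ = {0}`): `x ∈ Aᵢ`, `y ∈ A_l`, `x = y + c_l + cⱼ` force `i = j = l` and
`x = y`. [cite: CohnKleinbergSzegedyUmans2005, Def. 5.1] -/
theorem word (hS : IsSTPP (fun i => ({a i, q i} : Finset G5)) (fun _ => {0}) (fun i => {c i})) {i j l : Fin 6} {x y : G5}
    (hx : x = a i ∨ x = q i) (hy : y = a l ∨ y = q l) (he : x = y + c l + c j) : i = j ∧ j = l ∧ y = x := by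
  have hxm : x ∈ ({a i, q i} : Finset G5) := by rcases hx with rfl | rfl <;> simp
  have hym : y ∈ ({a l, q l} : Finset G5) := by rcases hy with rfl | rfl <;> simp
  have h := hS i j l y hym x hxm 0 (mem_singleton_self _) 0 (mem_singleton_self _) (c j) (mem_singleton_self _)
    (c l) (mem_singleton_self _) (by
      have e1 : x - y + (0 - 0) + (c l - c j) = c l + c l := by rw [he]; abel
      rw [e1, add_self5])
  exact ⟨h.1, h.2.1, h.2.2.1⟩

/-! ## The state of the true branch -/

/-- `used` mask after placing blocks `0 … m−1` of the family (exactly as the engine builds it). -/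
def usedM (a q : Fin 6 → G5) : ℕ → ℕ
  | 0 => 0
  | m + 1 => if h : m < 6 then Nat.lor (Nat.lor (usedM a q m) (bit (enc (a ⟨m, h⟩)))) (bit (enc (q ⟨m, h⟩))) else usedM a q m

/-- `F1` mask after placing blocks `0 … m−1` (exactly as the engine builds it from the tables `ts`). -/
def F1M (ts : List ℕ) (a q : Fin 6 → G5) : ℕ → ℕ
  | 0 => 0
  | m + 1 => if h : m < 6 then
      Nat.lor (Nat.lor (F1M ts a q m) (fld (ts.getD m 0) (enc (a ⟨m, h⟩)))) (fld (ts.getD m 0) (enc (q ⟨m, h⟩))) else F1M ts a q m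

/-- One-sided semantics of `usedM`: a set bit is the code of a placed point. -/
theorem usedM_spec : ∀ (m z : ℕ), (usedM a q m).testBit z = true → ∃ l : Fin 6, l.val < m ∧ (z = enc (a l) ∨ z = enc (q l))
  | 0, z, h => by simp [usedM] at h
  | m + 1, z, h => by
      unfold usedM at h
      split_ifs at h with hm
      · rw [testBit_lor', testBit_lor', Bool.or_eq_true, Bool.or_eq_true] at h
        rcases h with (h | h) | h
        · obtain ⟨l, hl, hz⟩ := usedM_spec m z h
          exact ⟨l, by omega, hz⟩
        · exact ⟨⟨m, hm⟩, by simp, Or.inl (testBit_bit h)⟩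
        · exact ⟨⟨m, hm⟩, by simp, Or.inr (testBit_bit h)⟩
      · obtain ⟨l, hl, hz⟩ := usedM_spec m z h
        exact ⟨l, by omega, hz⟩

variable {C ts : List ℕ}

/-- One-sided semantics of `F1M` (given the table check and the code list): a set bit is a code `enc (x + c_l + c_j)`, `x ∈ A_l`,
`l` placed. -/
theorem F1M_spec (htab : checkTabs C ts = true) (hC : C.length = 6) (hc : ∀ i : Fin 6, C.getD i.val 0 = enc (c i)) :
    ∀ (m z : ℕ), (F1M ts a q m).testBit z = true →
      ∃ l : Fin 6, l.val < m ∧ ∃ j : Fin 6, ∃ x, (x = a l ∨ x = q l) ∧ z = enc (x + c l + c j)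
  | 0, z, h => by simp [F1M] at h
  | m + 1, z, h => by
      unfold F1M at h
      split_ifs at h with hm
      · rw [testBit_lor', testBit_lor', Bool.or_eq_true, Bool.or_eq_true] at h
        have key : ∀ x : G5, (x = a ⟨m, hm⟩ ∨ x = q ⟨m, hm⟩) → (fld (ts.getD m 0) (enc x)).testBit z = true →
            ∃ l : Fin 6, l.val < m + 1 ∧ ∃ j : Fin 6, ∃ x, (x = a l ∨ x = q l) ∧ z = enc (x + c l + c j) := by
          intro x hx hz
          obtain ⟨j, hj, hzj⟩ := checkTabs_spec htab (by rw [hC]; exact hm) (enc_lt x) hz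
          refine ⟨⟨m, hm⟩, by simp, ⟨j, by rw [hC] at hj; exact hj⟩, x, hx, ?_⟩
          rw [hzj, hc ⟨m, hm⟩, hc ⟨j, _⟩, enc_add, enc_add]
        rcases h with (h | h) | h
        · obtain ⟨l, hl, rest⟩ := F1M_spec htab hC hc m z h
          exact ⟨l, by omega, rest⟩
        · exact key _ (Or.inl rfl) h
        · exact key _ (Or.inr rfl) h
      · obtain ⟨l, hl, rest⟩ := F1M_spec htab hC hc m z h
        exact ⟨l, by omega, rest⟩

/-! ## The true branch is never cut -/

section Main

/-- `a i ≠ q i` for code-oriented pairs. -/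
theorem a_ne_q (haq : ∀ i, enc (a i) < enc (q i)) (i : Fin 6) : a i ≠ q i := fun h => by
  have := haq i; rw [h] at this; exact lt_irrefl _ this

/-- A point of block `i` is not the code of a point of another block `l`. -/
theorem code_ne_of_ne (hS : IsSTPP (fun i => ({a i, q i} : Finset G5)) (fun _ => {0}) (fun i => {c i})) {i l : Fin 6} (hil : i ≠ l) {x y : G5} (hx : x = a i ∨ x = q i)
    (hy : y = a l ∨ y = q l) : enc x ≠ enc y := by
  intro h
  have hxy : x = y := enc_injective h
  have hw := word hS hx hy (j := l) (by rw [hxy, add_assoc, add_self5, add_zero])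
  exact hil (hw.1.trans hw.2.1)

/-- A point of block `i` is outside `A_l + c_l + cⱼ` for `l ≠ i` (the X-room condition `F1`). -/
theorem not_room (hS : IsSTPP (fun i => ({a i, q i} : Finset G5)) (fun _ => {0}) (fun i => {c i})) {i l j : Fin 6} (hil : i ≠ l) {x y : G5} (hx : x = a i ∨ x = q i)
    (hy : y = a l ∨ y = q l) : enc x ≠ enc (y + c l + c j) := by
  intro h
  have hw := word hS hx hy (enc_injective h)
  exact hil (hw.1.trans hw.2.1)

/-- A point of block `i` is outside `A_l + cᵢ + cⱼ` for `l ≠ i` as well (the candidate filter `S`). -/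
theorem not_room' (hS : IsSTPP (fun i => ({a i, q i} : Finset G5)) (fun _ => {0}) (fun i => {c i})) {i l j : Fin 6} (hil : i ≠ l) {x y : G5} (hx : x = a i ∨ x = q i)
    (hy : y = a l ∨ y = q l) : enc x ≠ enc (y + c i + c j) := by
  intro h
  have h2 : y = x + c i + c j := by
    rw [enc_injective h, show y + c i + c j + c i + c j = y + (c i + c i) + (c j + c j) by abel, add_self5, add_self5,
      add_zero, add_zero]
  have hw := word hS hy hx h2
  exact hil (hw.2.1.symm.trans hw.1.symm)

/-- The pair of block `i` passes the pair test: `aᵢ + qᵢ ∉ cᵢ + C`. -/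
theorem pair_ok (hS : IsSTPP (fun i => ({a i, q i} : Finset G5)) (fun _ => {0}) (fun i => {c i})) (haq : ∀ i, enc (a i) < enc (q i)) {i j : Fin 6} :
    Nat.xor (enc (a i)) (enc (q i)) ≠ Nat.xor (Nat.xor 0 (enc (c i))) (enc (c j)) := by
  intro h
  have h' : enc (a i + q i) = enc (0 + c i + c j) := by rw [enc_add, enc_add, enc_add, enc_zero, h]
  have h2 : a i = q i + c i + c j := by
    have e := enc_injective h'
    rw [zero_add] at e
    calc a i = a i + (q i + q i) := by rw [add_self5, add_zero]
      _ = (a i + q i) + q i := by abel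
      _ = (c i + c j) + q i := by rw [e]
      _ = q i + c i + c j := by abel
  have hw := word hS (Or.inl rfl) (Or.inr rfl) h2
  exact a_ne_q haq i hw.2.2.symm

/-- Points of blocks `≥ m` are outside `usedM m`. -/
theorem used_free (hS : IsSTPP (fun i => ({a i, q i} : Finset G5)) (fun _ => {0}) (fun i => {c i})) {m : ℕ} {i : Fin 6} (hi : m ≤ i.val) {x : G5} (hx : x = a i ∨ x = q i) :
    (usedM a q m).testBit (enc x) = false := by
  by_contra h
  rw [Bool.not_eq_false] at h
  obtain ⟨l, hl, hz⟩ := usedM_spec m _ h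
  have hil : i ≠ l := fun e => by rw [e] at hi; omega
  rcases hz with hz | hz
  · exact code_ne_of_ne hS hil hx (Or.inl rfl) hz
  · exact code_ne_of_ne hS hil hx (Or.inr rfl) hz

/-- Points of blocks `≥ m` are outside `F1M m`. -/
theorem F1_free (hS : IsSTPP (fun i => ({a i, q i} : Finset G5)) (fun _ => {0}) (fun i => {c i})) (htab : checkTabs C ts = true) (hC : C.length = 6) (hc : ∀ i : Fin 6, C.getD i.val 0 = enc (c i)) {m : ℕ} {i : Fin 6} (hi : m ≤ i.val)
    {x : G5} (hx : x = a i ∨ x = q i) : (F1M ts a q m).testBit (enc x) = false := by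
  by_contra h
  rw [Bool.not_eq_false] at h
  obtain ⟨l, hl, j, y, hy, hz⟩ := F1M_spec htab hC hc m _ h
  have hil : i ≠ l := fun e => by rw [e] at hi; omega
  exact not_room hS hil hx hy hz

/-- Points of blocks `≥ m` are in the free set `R = ∁(usedM m ∪ F1M m)`. -/
theorem mem_R (hS : IsSTPP (fun i => ({a i, q i} : Finset G5)) (fun _ => {0}) (fun i => {c i})) (htab : checkTabs C ts = true) (hC : C.length = 6) (hc : ∀ i : Fin 6, C.getD i.val 0 = enc (c i)) {m : ℕ} {i : Fin 6} (hi : m ≤ i.val)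
    {x : G5} (hx : x = a i ∨ x = q i) : (cpl (Nat.lor (usedM a q m) (F1M ts a q m))).testBit (enc x) = true := by
  rw [testBit_cpl, testBit_lor', used_free hS hi hx, F1_free hS htab hC hc hi hx]
  exact ⟨enc_lt x, rfl⟩

/-- The counting prune passes on the true branch: at least `2 · (6 − m)` free codes outside `usedM m ∪ F1M m`. -/
theorem hasBits_R (hS : IsSTPP (fun i => ({a i, q i} : Finset G5)) (fun _ => {0}) (fun i => {c i})) (haq : ∀ i, enc (a i) < enc (q i)) (htab : checkTabs C ts = true) (hC : C.length = 6) (hc : ∀ i : Fin 6, C.getD i.val 0 = enc (c i)) {m : ℕ} (hm : m < 6) :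
    hasBits (Nat.mul 2 (Nat.succ (5 - m))) (cpl (Nat.lor (usedM a q m) (F1M ts a q m))) = true := by
  let f : Fin (6 - m) × Bool → ℕ := fun kb =>
    enc (if kb.2 then q ⟨m + kb.1.val, by omega⟩ else a ⟨m + kb.1.val, by omega⟩)
  have hinj : Function.Injective f := by
    rintro ⟨k, b⟩ ⟨k', b'⟩ h
    by_cases hk : k = k'
    · subst hk
      cases b <;> cases b'
      · rfl
      · exact absurd (enc_injective h) (a_ne_q haq _)
      · exact absurd (enc_injective h).symm (a_ne_q haq _)
      · rfl
    · exfalso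
      have hne : (⟨m + k.val, by omega⟩ : Fin 6) ≠ ⟨m + k'.val, by omega⟩ := fun e => hk (by
        apply Fin.ext; have := congrArg Fin.val e; simp at this; omega)
      cases b <;> cases b'
      · exact code_ne_of_ne hS hne (Or.inl rfl) (Or.inl rfl) h
      · exact code_ne_of_ne hS hne (Or.inl rfl) (Or.inr rfl) h
      · exact code_ne_of_ne hS hne (Or.inr rfl) (Or.inl rfl) h
      · exact code_ne_of_ne hS hne (Or.inr rfl) (Or.inr rfl) h
  refine hasBits_of_card _ _ (univ.image f) (fun z hz => ?_) ?_
  · obtain ⟨⟨k, b⟩, _, rfl⟩ := mem_image.1 hz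
    cases b
    · exact mem_R hS htab hC hc (i := ⟨m + k.val, by omega⟩) (by simp) (Or.inl rfl)
    · exact mem_R hS htab hC hc (i := ⟨m + k.val, by omega⟩) (by simp) (Or.inr rfl)
  · rw [card_image_of_injective _ hinj, card_univ, Fintype.card_prod, Fintype.card_fin, Fintype.card_bool, mul_eq']
    omega

/-! ## Unfolding one level of the engine -/

/-- The cons case of `go`, with the `force`s evaluated. -/
theorem go_cons (T : ℕ) (rest : List ℕ) (U F : ℕ) : go (T :: rest) U F =
    (!(hasBits (Nat.mul 2 (Nat.succ (List.length rest))) (cpl (Nat.lor U F))) ||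
      allBits (Nat.land (cpl (Nat.lor U F)) (cpl (spread T U))) (fun x =>
        allBits (Nat.land (Nat.land (cpl (Nat.lor U F)) (cpl (spread T U))) (Nat.xor full5 (lowMask (Nat.add x 1))))
          (fun x2 => Nat.testBit (fld T 0) (Nat.xor x x2) ||
            go rest (Nat.lor (Nat.lor U (bit x)) (bit x2)) (Nat.lor (Nat.lor F (fld T x)) (fld T x2)))
          (Nat.land (Nat.land (cpl (Nat.lor U F)) (cpl (spread T U))) (Nat.xor full5 (lowMask (Nat.add x 1)))))
        (Nat.land (cpl (Nat.lor U F)) (cpl (spread T U)))) := by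
  rw [show go (T :: rest) U F =
      (force (cpl (Nat.lor U F)) fun R =>
      !(hasBits (Nat.mul 2 (Nat.succ (List.length rest))) R) ||
      force (fld T 0) fun P =>
      force (Nat.land R (cpl (spread T U))) fun S =>
      allBits S (fun x =>
        force (Nat.land S (Nat.xor full5 (lowMask (Nat.add x 1)))) fun S2 =>
        force (Nat.lor F (fld T x)) fun F1a =>
        force (Nat.lor U (bit x)) fun Ua =>
        allBits S2 (fun x2 =>
          Nat.testBit P (Nat.xor x x2) ||
          go rest (Nat.lor Ua (bit x2)) (Nat.lor F1a (fld T x2)))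
        S2)
      S) from rfl]
  simp only [force_eq]

end Main

end Family

end T1Z2p5

end Summit.MatrixMultiplication.OmegaCensus
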